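import Literature.NumberTheory.Automorphic.AutomorphicMeasureGLDomain
import Literature.NumberTheory.Automorphic.IdeleNormDetGL
import Literature.NumberTheory.Automorphic.AdelicHeightGLSiegel
import HarnessLib

/-!
# Normalising the determinant by the centre: `g ↦ g♮ = g · z(|det g|_𝔸^{-1/(n[K:ℚ])})`

Topic `NumberTheory/Automorphic`; namespace `Literature.NumberTheory.Automorphic`. On `GL_n(𝔸_K)`
(`n ≥ 1`) every coset `g A_G` of the split component `A_G = {z(ρ)}` contains exactly one element of
idelic determinant norm `1`, namely `g♮ = g · z(e^{-log|det g|_𝔸/(n[K:ℚ])})` (Borel–Jacquet (1979),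
§1.1, `G(𝔸) = A_G · G(𝔸)¹`; Godement–Jacquet (1972), §10). This file records the normalisation as a
continuous map and its bookkeeping, used to turn `A_G`-invariant quantities with polynomial bounds
in `‖g‖` into genuinely `A_G`-invariant polynomial majorants (Godement–Jacquet §12):

* `detNormParam`, `detNormalize` (`g♮`); `continuous_detNormalize`;
* `glAbsDet_detNormalize` — `|det g♮|_𝔸 = 1`;
* `detNormalize_mul_posRealScalar` — `(g z)♮ = g♮` for `z ∈ A_G`;
* `detNormalize_mul_of_glAbsDet_eq_one`, `detNormalize_mul_left_of_glAbsDet_eq_one` —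
  `(g h)♮ = g♮ h`, `(h g)♮ = h g♮` when `|det h|_𝔸 = 1` (e.g. `h` rational);
* `detNormalize_inv` — `(g⁻¹)♮ = (g♮)⁻¹`;
* `adelicHeightGL_detNormalize_le` — **`‖g♮‖ ≤ n (n!)^{1/n} (1 ⊔ ‖g‖)²`**
  (`adelicHeightGL_posRealScalar_le` and the determinant bounds `ideleNorm_det_le_height`,
  `ideleNorm_det_inv_le_height` of `IdeleNormDetGL`).

## References

* A. Borel, H. Jacquet, *Automorphic forms and automorphic representations*, Proc. Sympos. Pure
  Math. 33 (1979), Part 1, §1.1–1.2 [BorelJacquetCorvallis1979].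
* R. Godement, H. Jacquet, *Zeta functions of simple algebras*, LNM 260 (1972), §10, §12
  [GodementJacquetLNM260].
-/

noncomputable section

open scoped NNReal
open NumberField IsDedekindDomain Set

namespace Literature.NumberTheory.Automorphic

variable (n : ℕ) (K : Type) [Field K] [NumberField K]

/-- The real parameter `-log |det g|_𝔸 / (n [K:ℚ])` of the normalising scalar. [folklore] -/
def detNormParam (g : GL (Fin n) (AdeleRing (𝓞 K) K)) : ℝ :=
  -Real.log (((glAbsDet n K g : ℝ≥0ˣ) : ℝ≥0) : ℝ) / ((n * Module.finrank ℚ K : ℕ) : ℝ)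

/-- **The determinant normalisation** `g♮ = g · z(e^{-log|det g|/(n[K:ℚ])})`: the element of the
coset `g A_G` of idelic determinant norm `1` (`n ≥ 1`). [folklore] -/
def detNormalize (g : GL (Fin n) (AdeleRing (𝓞 K) K)) : GL (Fin n) (AdeleRing (𝓞 K) K) :=
  g * posRealScalar n K (expUnitNNReal (detNormParam n K g))

variable {n K}

/-- Unfolding of `detNormalize`. [folklore] -/
theorem detNormalize_apply (g : GL (Fin n) (AdeleRing (𝓞 K) K)) :
    detNormalize n K g = g * posRealScalar n K (expUnitNNReal (detNormParam n K g)) := rfl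

/-- `|det g|_𝔸 > 0` as a real number (same statement as `glAbsDet_real_pos` of
`JPSSGlobalIntegral`, not imported here). [folklore] -/
theorem glAbsDet_real_pos' (g : GL (Fin n) (AdeleRing (𝓞 K) K)) :
    0 < (((glAbsDet n K g : ℝ≥0ˣ) : ℝ≥0) : ℝ) :=
  NNReal.coe_pos.2 (pos_iff_ne_zero.2 (glAbsDet n K g).ne_zero)

/-- `|det z(e^v)|_𝔸 = e^{n [K:ℚ] v}`. [folklore] -/
theorem glAbsDet_posRealScalar_expUnitNNReal_real (v : ℝ) :
    (((glAbsDet n K (posRealScalar n K (expUnitNNReal v)) : ℝ≥0ˣ) : ℝ≥0) : ℝ) =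
      Real.exp (((n * Module.finrank ℚ K : ℕ) : ℝ) * v) := by
  rw [glAbsDet_posRealScalar, Units.val_pow_eq_pow_val, NNReal.coe_pow, coe_expUnitNNReal,
    ← Real.exp_nat_mul]

/-- **`detNormalize` is continuous.** [folklore] -/
theorem continuous_detNormalize : Continuous (detNormalize n K) := by
  refine continuous_id.mul ((continuous_posRealScalar_expUnitNNReal n K).comp ?_)
  refine (Continuous.log ?_ fun g => (glAbsDet_real_pos' g).ne').neg.div_const _
  exact continuous_glAbsDet_real n K

/-- **`|det g♮|_𝔸 = 1`** (`n ≥ 1`). [folklore] -/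
theorem glAbsDet_detNormalize (hn : 0 < n) (g : GL (Fin n) (AdeleRing (𝓞 K) K)) :
    glAbsDet n K (detNormalize n K g) = 1 := by
  have hN : ((n * Module.finrank ℚ K : ℕ) : ℝ) ≠ 0 := by
    exact_mod_cast Nat.mul_ne_zero hn.ne' Module.finrank_pos.ne'
  refine Units.ext (NNReal.eq ?_)
  rw [detNormalize_apply, map_mul, Units.val_mul, NNReal.coe_mul, glAbsDet_posRealScalar_expUnitNNReal_real,
    detNormParam, mul_div_cancel₀ _ hN, Real.exp_neg, Real.exp_log (glAbsDet_real_pos' g),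
    mul_inv_cancel₀ (glAbsDet_real_pos' g).ne', Units.val_one, NNReal.coe_one]

/-- Positive real scalars commute with everything. [folklore] -/
theorem posRealScalar_comm (r : ℝ≥0ˣ) (g : GL (Fin n) (AdeleRing (𝓞 K) K)) :
    g * posRealScalar n K r = posRealScalar n K r * g :=
  Subgroup.mem_center_iff.1 (posRealScalar_mem_center n K r) g

/-- **`A_G`-invariance**: `(g z(r))♮ = g♮`. [folklore] -/
theorem detNormalize_mul_posRealScalar (hn : 0 < n) (g : GL (Fin n) (AdeleRing (𝓞 K) K)) (r : ℝ≥0ˣ) :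
    detNormalize n K (g * posRealScalar n K r) = detNormalize n K g := by
  have hN : ((n * Module.finrank ℚ K : ℕ) : ℝ) ≠ 0 := by
    exact_mod_cast Nat.mul_ne_zero hn.ne' Module.finrank_pos.ne'
  have hr : 0 < ((r : ℝ≥0) : ℝ) := NNReal.coe_pos.2 (pos_iff_ne_zero.2 r.ne_zero)
  -- the parameters: `p(g z(r)) = p(g) - log r`
  have hparam : detNormParam n K (g * posRealScalar n K r) = detNormParam n K g - Real.log ((r : ℝ≥0) : ℝ) := by
    rw [detNormParam, detNormParam, map_mul, Units.val_mul, NNReal.coe_mul, glAbsDet_posRealScalar,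
      Units.val_pow_eq_pow_val, NNReal.coe_pow, Real.log_mul (glAbsDet_real_pos' g).ne' (pow_pos hr _).ne',
      Real.log_pow]
    field_simp
    ring
  have hexp : expUnitNNReal (detNormParam n K g - Real.log ((r : ℝ≥0) : ℝ)) = expUnitNNReal (detNormParam n K g) * r⁻¹ := by
    refine Units.ext (NNReal.eq ?_)
    rw [coe_expUnitNNReal, Units.val_mul, NNReal.coe_mul, coe_expUnitNNReal, Units.val_inv_eq_inv_val,
      NNReal.coe_inv, Real.exp_sub, Real.exp_log hr, div_eq_mul_inv]
  rw [detNormalize_apply, detNormalize_apply, hparam, hexp, map_mul, map_inv, mul_assoc,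
    ← mul_assoc (posRealScalar n K r), ← posRealScalar_comm, mul_assoc, mul_inv_cancel, mul_one]

/-- **Right equivariance under elements of norm `1`**: `(g h)♮ = g♮ h` when `|det h|_𝔸 = 1`. [folklore] -/
theorem detNormalize_mul_of_glAbsDet_eq_one (g : GL (Fin n) (AdeleRing (𝓞 K) K)) {h : GL (Fin n) (AdeleRing (𝓞 K) K)}
    (hh : glAbsDet n K h = 1) : detNormalize n K (g * h) = detNormalize n K g * h := by
  have hparam : detNormParam n K (g * h) = detNormParam n K g := by
    rw [detNormParam, detNormParam, map_mul, hh, mul_one]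
  rw [detNormalize_apply, detNormalize_apply, hparam, mul_assoc, mul_assoc, posRealScalar_comm]

/-- **Left equivariance under elements of norm `1`**: `(h g)♮ = h g♮` when `|det h|_𝔸 = 1`. [folklore] -/
theorem detNormalize_mul_left_of_glAbsDet_eq_one {h : GL (Fin n) (AdeleRing (𝓞 K) K)}
    (hh : glAbsDet n K h = 1) (g : GL (Fin n) (AdeleRing (𝓞 K) K)) :
    detNormalize n K (h * g) = h * detNormalize n K g := by
  have hparam : detNormParam n K (h * g) = detNormParam n K g := by
    rw [detNormParam, detNormParam, map_mul, hh, one_mul]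
  rw [detNormalize_apply, detNormalize_apply, hparam, mul_assoc]

/-- **Inversion**: `(g⁻¹)♮ = (g♮)⁻¹`. [folklore] -/
theorem detNormalize_inv (g : GL (Fin n) (AdeleRing (𝓞 K) K)) :
    detNormalize n K g⁻¹ = (detNormalize n K g)⁻¹ := by
  have hparam : detNormParam n K g⁻¹ = -detNormParam n K g := by
    rw [detNormParam, detNormParam, map_inv, Units.val_inv_eq_inv_val, NNReal.coe_inv, Real.log_inv]
    ring
  have hexp : expUnitNNReal (-detNormParam n K g) = (expUnitNNReal (detNormParam n K g))⁻¹ := by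
    refine Units.ext (NNReal.eq ?_)
    rw [coe_expUnitNNReal, Units.val_inv_eq_inv_val, NNReal.coe_inv, coe_expUnitNNReal, Real.exp_neg]
  rw [detNormalize_apply, detNormalize_apply, hparam, hexp, map_inv, mul_inv_rev, ← map_inv, posRealScalar_comm]

/-- **The height of `g♮` is polynomial in the height of `g`**:
`‖g♮‖ ≤ n (n!)^{1/n} (1 ⊔ ‖g‖)²` (`‖z(ρ)‖ ≤ ρ ⊔ ρ⁻¹` with `ρ^{±1} = |det g|^{∓1/(n[K:ℚ])}`, and
`|det g|^{±1} ≤ (n!)^{[K:ℚ]} (1 ⊔ ‖g‖)^{n[K:ℚ]}`). [folklore] -/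
theorem adelicHeightGL_detNormalize_le [NeZero n] (g : GL (Fin n) (AdeleRing (𝓞 K) K)) :
    adelicHeightGL n K (detNormalize n K g) ≤
      n * (n.factorial : ℝ) ^ ((n : ℝ)⁻¹) * (1 ⊔ adelicHeightGL n K g) ^ 2 := by
  have hn : 0 < n := Nat.pos_of_ne_zero (NeZero.ne n)
  set d : ℕ := Module.finrank ℚ K with hd
  set N : ℝ := ((n * d : ℕ) : ℝ) with hN
  have hd0 : 0 < d := Module.finrank_pos
  have hN0 : 0 < N := by rw [hN]; exact_mod_cast Nat.mul_pos hn hd0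
  set D : ℝ := (((glAbsDet n K g : ℝ≥0ˣ) : ℝ≥0) : ℝ) with hD
  have hD0 : 0 < D := glAbsDet_real_pos' g
  set H : ℝ := 1 ⊔ adelicHeightGL n K g with hH
  have hH1 : 1 ≤ H := le_sup_left
  have hH0 : 0 < H := one_pos.trans_le hH1
  set F : ℝ := (n.factorial : ℝ) ^ d with hF
  have hF0 : 0 < F := by positivity
  -- `ρ = e^{p(g)} = D^{-1/N}`, and `ρ ⊔ ρ⁻¹ ≤ (F H^{n d})^{1/N} = (n!)^{1/n} H`
  set ρ : ℝ≥0ˣ := expUnitNNReal (detNormParam n K g) with hρ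
  have hρval : ((ρ : ℝ≥0) : ℝ) = D ^ (-N⁻¹) := by
    rw [hρ, coe_expUnitNNReal, detNormParam, Real.rpow_def_of_pos hD0, ← hD, ← hN]
    congr 1
    ring
  have hbound : ∀ t : ℝ, 0 < t → t ≤ F * H ^ (n * d) → t ^ N⁻¹ ≤ (n.factorial : ℝ) ^ ((n : ℝ)⁻¹) * H := by
    intro t ht hle
    calc t ^ N⁻¹ ≤ (F * H ^ (n * d)) ^ N⁻¹ := Real.rpow_le_rpow ht.le hle (inv_nonneg.2 hN0.le)
      _ = F ^ N⁻¹ * (H ^ (n * d)) ^ N⁻¹ := Real.mul_rpow hF0.le (pow_nonneg hH0.le _)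
      _ = (n.factorial : ℝ) ^ ((n : ℝ)⁻¹) * H := by
          congr 1
          · rw [hF, ← Real.rpow_natCast, ← Real.rpow_mul (Nat.cast_nonneg _), hN]
            congr 1
            push_cast
            field_simp
          · rw [← Real.rpow_natCast, ← Real.rpow_mul hH0.le, hN]
            push_cast
            rw [mul_inv_cancel₀ (by positivity : (n : ℝ) * d ≠ 0), Real.rpow_one]
  have hDle : D ≤ F * H ^ (n * d) := by
    have h := ideleNorm_det_le_height (K := K) g
    rwa [← coe_ideleNorm] at h
  have hDinv : D⁻¹ ≤ F * H ^ (n * d) := by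
    have h := ideleNorm_det_inv_le_height (K := K) g
    rwa [← coe_ideleNorm] at h
  have hmax : max ((ρ : ℝ≥0) : ℝ) (((ρ : ℝ≥0) : ℝ))⁻¹ ≤ (n.factorial : ℝ) ^ ((n : ℝ)⁻¹) * H := by
    rw [hρval]
    refine max_le ?_ ?_
    · rw [Real.rpow_neg hD0.le, ← Real.inv_rpow hD0.le]
      exact hbound D⁻¹ (inv_pos.2 hD0) hDinv
    · rw [Real.rpow_neg hD0.le, inv_inv]
      exact hbound D hD0 hDle
  calc adelicHeightGL n K (detNormalize n K g)
      ≤ n * adelicHeightGL n K g * adelicHeightGL n K (posRealScalar n K ρ) := adelicHeightGL_mul_le_const _ _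
    _ ≤ n * H * ((n.factorial : ℝ) ^ ((n : ℝ)⁻¹) * H) := by
        refine mul_le_mul (mul_le_mul_of_nonneg_left le_sup_right (Nat.cast_nonneg _))
          ((adelicHeightGL_posRealScalar_le ρ).trans hmax) (adelicHeightGL_nonneg _) (by positivity)
    _ = n * (n.factorial : ℝ) ^ ((n : ℝ)⁻¹) * H ^ 2 := by ring

end Literature.NumberTheory.Automorphic
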